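import Literature.Probability.RandomPlanarGeometry.HexSAWBrickWallStripFugacityWidthOneContactPhaseCorners
import HarnessLib

/-!
# The zigzag phase at vanishing fugacity: its cost in closed form and its vanishing limit

Child module of `…ContactPhaseCorners` (the cost `log μ₁(y,z) − (log y + log z)/6` of the zigzag vertex `(1/6,1/6)`, positive for all
finite fugacities).  On the diagonal `y = z` the sextic law is `s(s − y)² = y²` (`s = μ₁(y,y)²`), which gives the cost EXACTLY:
* §1 ★★ `zigzagCost_diag_eq`: `log μ₁(y,y) − (log y)/3 = −(1/3)·log(1 − y/μ₁(y,y)²)` for every `y > 0`; and `(y/μ₁(y,y)²)³ ≤ y`;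
* §2 ★★★ **`tendsto_zigzagCost_diag_nhdsGT_zero`**: the cost tends to `0` as `y → 0⁺` — infinitely REPELLING walls force the zigzag (a rung at
  every third step, the tree's `tendsto_twoWallRho_ray_nhdsGT_zero`) at vanishing exponential cost, the mirror image of the adsorbed phase at
  `y → ∞` (`tendsto_adsorptionCost_atTop`).  Equivalently `μ₁(y,y)³ ∼ y` as `y → 0⁺`.

## Sources
JansevanRensburg2000 §3.3, §5 (1st ed., OUP 2000); BeatonBousquetMelouDeGierDuminilCopinGuttmann2014 §3.2 Proposition 6 (arXiv v5 p. 10: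
the strip `S_1`, `μ_1(y,y)`).  Nothing quoted AS PRINTED; statements are this lineage's.
-/

noncomputable section

open Filter Topology Finset Literature.Probability.LatticeModels Literature.Probability.Percolation SimpleGraph

namespace Literature.Probability.RandomPlanarGeometry.SAW.HexBW

open WidthOneYZ Real

variable {y : ℝ}

/-! ## §1 The zigzag cost on the diagonal in closed form -/

/-- On the diagonal the sextic law reads `s(s − y)² = y²`, `s = μ₁(y,y)²`, hence `s³/y² = (1 − y/s)⁻²`.
[cite: BeatonBousquetMelouDeGierDuminilCopinGuttmann2014, §3.2 Proposition 6 (arXiv v5 p. 10; lane algebra on the tree's sextic law)] -/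
theorem stripMuY₂_diag_cube_div (hy : 0 < y) :
    (stripMuY₂ 1 y y ^ 2) ^ 3 / y ^ 2 = 1 / (1 - y / stripMuY₂ 1 y y ^ 2) ^ 2 := by
  set s := stripMuY₂ 1 y y ^ 2 with hs
  have hlaw := stripMuY₂_one_sq_poly_eq hy hy
  rw [← hs] at hlaw
  have hsy : y < s := lt_of_le_of_lt (le_max_left _ _) (by rw [hs]; exact max_lt_stripMuY₂_one_sq hy hy)
  have hs0 : 0 < s := hy.trans hsy
  have hsub : 0 < s - y := by linarith
  have e1 : 1 - y / s = (s - y) / s := by field_simp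
  rw [e1]
  have hlaw' : s * (s - y) ^ 2 = y ^ 2 := by nlinarith [hlaw]
  rw [div_pow, one_div_div, div_eq_div_iff (pow_pos hy 2).ne' (pow_pos hsub 2).ne']
  nlinarith [hlaw']

/-- `(y/s)³ ≤ y` on the diagonal (`s = μ₁(y,y)²`: `s³ ≥ s(s−y)² = y²`). [cite: BeatonBousquetMelouDeGierDuminilCopinGuttmann2014, §3.2 Proposition 6 (arXiv v5 p. 10; lane estimate)] -/
theorem div_stripMuY₂_diag_pow_three_le (hy : 0 < y) :
    0 < y / stripMuY₂ 1 y y ^ 2 ∧ y / stripMuY₂ 1 y y ^ 2 < 1 ∧ (y / stripMuY₂ 1 y y ^ 2) ^ 3 ≤ y := by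
  set s := stripMuY₂ 1 y y ^ 2 with hs
  have hlaw := stripMuY₂_one_sq_poly_eq hy hy
  rw [← hs] at hlaw
  have hsy : y < s := lt_of_le_of_lt (le_max_left _ _) (by rw [hs]; exact max_lt_stripMuY₂_one_sq hy hy)
  have hs0 : 0 < s := hy.trans hsy
  refine ⟨div_pos hy hs0, (div_lt_one hs0).2 hsy, ?_⟩
  -- `s³ ≥ y²`: since `(s - y)² ≤ s²`
  have h3 : y ^ 2 ≤ s ^ 3 := by nlinarith [hlaw, mul_pos hs0 hy]
  rw [div_pow, div_le_iff₀ (pow_pos hs0 3)]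
  nlinarith [h3]

/-- ★★ **THE ZIGZAG COST ON THE DIAGONAL IN CLOSED FORM**: for every `y > 0`,
`log μ₁(y,y) − (log y)/3 = −(1/3)·log(1 − y/μ₁(y,y)²)` (so the cost of the zigzag under `P_{N,y,y}`, `log μ₁ − (log y + log y)/6`, is an
explicit function of the ratio `y/μ₁²`). [cite: JansevanRensburg2000, §3.3 (1st ed.; lane statement)] -/
theorem zigzagCost_diag_eq (hy : 0 < y) :
    Real.log (stripMuY₂ 1 y y) - Real.log y / 3 = -(1 / 3) * Real.log (1 - y / stripMuY₂ 1 y y ^ 2) := by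
  obtain ⟨hq0, hq1, -⟩ := div_stripMuY₂_diag_pow_three_le hy
  have hμ := stripMuY₂_pos 1 hy hy
  have hcube := stripMuY₂_diag_cube_div hy
  have h1q : 0 < 1 - y / stripMuY₂ 1 y y ^ 2 := by linarith
  -- take logarithms of `s³/y² = (1 − y/s)⁻²`
  have hlog := congrArg Real.log hcube
  rw [Real.log_div (pow_pos (pow_pos hμ 2) 3).ne' (pow_pos hy 2).ne', Real.log_pow, Real.log_pow, Real.log_pow,
    one_div, Real.log_inv, Real.log_pow] at hlog
  push_cast at hlog
  linarith

/-! ## §2 The zigzag becomes free at vanishing fugacity -/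

/-- ★★★ **THE COST OF THE ZIGZAG VANISHES AS `y = z → 0⁺`**: `log μ₁(y,y) − (log y)/3 → 0` — equivalently `μ₁(y,y)³/y → 1`: infinitely
repelling walls make the rung-at-every-third-step phase exponentially free (mirror statement of `tendsto_adsorptionCost_atTop`).
[cite: JansevanRensburg2000, §3.3 and §5 (1st ed.; lane statement); BeatonBousquetMelouDeGierDuminilCopinGuttmann2014, §3.2 Proposition 6 (arXiv v5 p. 10)] -/
theorem tendsto_zigzagCost_diag_nhdsGT_zero :
    Tendsto (fun y : ℝ => Real.log (stripMuY₂ 1 y y) - Real.log y / 3) (𝓝[>] 0) (𝓝 0) := by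
  -- the ratio `q(y) = y/μ₁(y,y)²` tends to `0⁺` (`q³ ≤ y`), and the cost is `−(1/3) log(1 − q)`
  have hq : Tendsto (fun y : ℝ => y / stripMuY₂ 1 y y ^ 2) (𝓝[>] 0) (𝓝 0) := by
    rw [Metric.tendsto_nhdsWithin_nhds]
    intro ε hε
    refine ⟨min 1 (ε ^ 3), lt_min one_pos (pow_pos hε 3), fun {y} hy hdist => ?_⟩
    have hy0 : 0 < y := hy
    rw [dist_zero_right, Real.norm_eq_abs, abs_of_pos hy0] at hdist
    obtain ⟨hq0, -, hq3⟩ := div_stripMuY₂_diag_pow_three_le hy0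
    rw [dist_zero_right, Real.norm_eq_abs, abs_of_pos hq0]
    have hyε : y < ε ^ 3 := lt_of_lt_of_le hdist (min_le_right _ _)
    by_contra hge
    push Not at hge
    have : ε ^ 3 ≤ (y / stripMuY₂ 1 y y ^ 2) ^ 3 := by
      exact pow_le_pow_left₀ hε.le hge 3
    linarith
  have hlog : Tendsto (fun y : ℝ => -(1 / 3) * Real.log (1 - y / stripMuY₂ 1 y y ^ 2)) (𝓝[>] 0) (𝓝 (-(1 / 3) * Real.log (1 - 0))) := by
    refine ((Real.continuousAt_log (by norm_num : (1 : ℝ) - 0 ≠ 0)).tendsto.comp ?_).const_mul _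
    exact tendsto_const_nhds.sub hq
  rw [sub_zero, Real.log_one, mul_zero] at hlog
  refine hlog.congr' ?_
  refine eventually_nhdsWithin_of_forall fun y hy => ?_
  exact (zigzagCost_diag_eq hy).symm

end Literature.Probability.RandomPlanarGeometry.SAW.HexBW
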